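import Mathlib.Data.Sym.Card
import Mathlib.Data.Finsupp.Multiset
import Summits.HodgeConjecture.HodgeConjecture.Theorems.CyclicUnitaryPowersFermatEigenformVanishing
import Summits.HodgeConjecture.HodgeConjecture.Theorems.CyclicUnitaryPowersK1OfFermatGenusLe
import Literature.AlgebraicGeometry.HodgeTheory.BettiHodgeNumbersOfHodgeModels
import Literature.AlgebraicGeometry.HodgeTheory.HodgeTypeProjectors
import Literature.AlgebraicGeometry.HodgeTheory.DiagonalSymmetryStability
import Literature.AlgebraicGeometry.HodgeTheory.FermatEigenspaceMultiplicityOne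

/-!
# `h^{2,0}(X²_p) ≤ C(p-1, 3)` for the Fermat surface, and K1-A from {F1‡, CDK} (programme PG-FERMAT, brick F4b — the glue)

Prover seat `hodge-nonav-prover-Bx` (g10), cell `hodge-nonav`, crux K1-A (stmt-HodgeConjecture-19544,
`Summit.HodgeConjecture.HodgeConjecture.Theses.CyclicUnitaryPowers.VeryGeneralDeckCommutatorsInHg`). The registry's geometric-genus stub
PG (`Arapura2012_hypersurface_geometricGenus`) enters K1 only as the inequality `hFermatLe : h^{2,0}(X²_p) ≤ C(p-1, 3)` for primes
`p ≥ 5` (`CyclicUnitaryPowersK1OfFermatGenusLe`). This file PROVES `hFermatLe` (for every `p ≥ 4`) and re-cuts K1: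

* `card_levelOne_eq_choose` — `#{β ∈ (ℤ/p)⁴ : βᵢ ≠ 0, Σ ⟨βᵢ⟩ = p} = C(p-1, 3)` (stars and bars: `⟨βᵢ⟩ - 1` is a composition of
  `p - 4` into `4` parts; Mathlib's `Sym.card_sym_eq_choose`).
* `typePiece_twoZero_le_iSup_fermatEigenspace` — the `(2,0)` type piece of `H²(X²_p(ℂ); ℂ)` lies in `⨁_{β level 1} V(β)`: a
  `(2,0)`-class is the sum of its isotypic components `π_β c` (`sum_eigenProjector_apply`), each a `(2,0)`-class of `V(β)`
  (`HodgeModel.pullback_eigenProjector_mem_hodgePQ`), which vanishes unless `β` is admissible of level `1`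
  (`fermatEigenspace_eq_bot_of_sum_ne_zero`, and the PG-FERMAT vanishing theorems `fermatEigenspace_twoZero_eq_zero_of_two_le_level`,
  `fermatEigenspace_twoZero_eq_zero_of_exists_eq_zero`).
* `hodgeNumber_two_zero_fermat_le` — **`h^{2,0}(X²_p) ≤ C(p-1, 3)`** (`p ≥ 4`): each `V(β)`, `β ≠ 0`, is a line at most
  (`fermatEigenspace_le_span_of_ne_zero`). With the tree's residue lower bound this is Shioda's `p_g(X²_p) = C(p-1,3)`
  (`hodgeNumber_two_zero_fermat_eq`).
* `veryGeneralDeckCommutatorsInHg_of_localMonodromyBound_cdk` — **K1-A ⟸ {F1‡, CDK}**: the crux from the two remaining named facts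
  `carlsonToledo1999_nodalMeridianLocalMonodromyBound` (F1‡) and `cmsp_nonHodgeGenericPoints_countable_algebraic_cover` (CDK) only —
  the geometric-genus input is DISCHARGED; likewise the rung leaf (`cyclicSurfacePowersHodge_of_localMonodromyBound_cdk`) and the F1† road.

Sorry-free; no definition, no new named fact; CONDITIONAL on F1‡ and CDK exactly as displayed; nothing here says HC ∕ HC_AV is proved
(rung F-H1 not moved). [cite: Shioda1979HodgeFermat, §1 (1.7)]
-/

noncomputable section

set_option linter.dupNamespace false

open scoped Manifold ContDiff Topology
open Set Function

namespace Summit.HodgeConjecture.HodgeConjecture.Theorems.CyclicUnitaryPowersFermatGeometricGenusBound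

open Literature.AlgebraicGeometry.HodgeTheory Literature.AlgebraicGeometry.Motives Literature.NumberTheory.Transcendental
  Literature.AlgebraicTopology.SingularHomology
  Summit.HodgeConjecture.HodgeConjecture.Theorems.CyclicUnitaryPowersFermatEigenformVanishing
  Summit.HodgeConjecture.HodgeConjecture.Theorems.CyclicUnitaryPowersK1OfFermatGenus
  Summit.HodgeConjecture.HodgeConjecture.Theorems.CyclicUnitaryPowersK1OfFermatGenusLe

/-! ### Counting the characters of level one -/

/-- **Stars and bars for the level-one characters**: for `p ≥ 4`, the characters `β ∈ (ℤ/p)⁴` with all `βᵢ ≠ 0` and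
`Σ ⟨βᵢ⟩ = p` are `C(p-1, 3)` in number (`βᵢ ↦ ⟨βᵢ⟩ - 1` is a bijection onto the `4`-tuples of naturals with sum `p - 4`, counted
by `Sym.card_sym_eq_choose`). [cite: Shioda1979HodgeFermat, §1 (1.7)] -/
theorem card_levelOne_eq_choose {p : ℕ} [NeZero p] (hp : 4 ≤ p) :
    Fintype.card {β : Fin 4 → ZMod p // (∀ i, β i ≠ 0) ∧ ∑ i, (β i).val = p} = Nat.choose (p - 1) 3 := by
  classical
  haveI : Fintype {b : Fin 4 → ℕ // ∑ i, b i = p - 4} := Fintype.ofEquiv _ (Sym.equivNatSumOfFintype (Fin 4) (p - 4))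
  have hpos : ∀ {β : Fin 4 → ZMod p} (i), β i ≠ 0 → 1 ≤ (β i).val := fun i h ↦
    Nat.one_le_iff_ne_zero.2 fun h0 ↦ h ((ZMod.val_eq_zero _).1 h0)
  let e : {β : Fin 4 → ZMod p // (∀ i, β i ≠ 0) ∧ ∑ i, (β i).val = p} ≃ {b : Fin 4 → ℕ // ∑ i, b i = p - 4} :=
    { toFun := fun β ↦ ⟨fun i ↦ (β.1 i).val - 1, by
        have h := β.2.2
        have h0 := hpos 0 (β.2.1 0); have h1 := hpos 1 (β.2.1 1); have h2 := hpos 2 (β.2.1 2); have h3 := hpos 3 (β.2.1 3)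
        simp only [Fin.sum_univ_four] at h ⊢
        omega⟩
      invFun := fun b ↦ ⟨fun i ↦ ((b.1 i + 1 : ℕ) : ZMod p), by
        have hb := b.2
        have hlt : ∀ i, b.1 i + 1 < p := by
          intro i
          have : b.1 i ≤ ∑ j, b.1 j := Finset.single_le_sum (f := b.1) (fun j _ ↦ Nat.zero_le _) (Finset.mem_univ i)
          omega
        have hval : ∀ i, (((b.1 i + 1 : ℕ) : ZMod p)).val = b.1 i + 1 := fun i ↦ ZMod.val_cast_of_lt (hlt i)
        refine ⟨fun i h0 ↦ ?_, ?_⟩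
        · have := congrArg ZMod.val h0
          rw [hval, ZMod.val_zero] at this
          omega
        · simp only [hval, Fin.sum_univ_four] at hb ⊢
          omega⟩
      left_inv := fun β ↦ by
        apply Subtype.ext
        funext i
        have h1 := hpos i (β.2.1 i)
        simp only [Nat.sub_add_cancel h1, ZMod.natCast_zmod_val]
      right_inv := fun b ↦ by
        apply Subtype.ext
        funext i
        have hlt : b.1 i + 1 < p := by
          have hb := b.2
          have : b.1 i ≤ ∑ j, b.1 j := Finset.single_le_sum (f := b.1) (fun j _ ↦ Nat.zero_le _) (Finset.mem_univ i)
          omega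
        simp only [ZMod.val_cast_of_lt hlt, Nat.add_sub_cancel] }
  rw [Fintype.card_congr e, ← Fintype.card_congr (Sym.equivNatSumOfFintype (Fin 4) (p - 4)), Sym.card_sym_eq_choose,
    Fintype.card_fin, show 4 + (p - 4) - 1 = p - 1 by omega]
  rw [show p - 4 = (p - 1) - 3 by omega]
  exact Nat.choose_symm (by omega)

/-! ### The `(2,0)` type piece of `H²(X²_p)` lies in the level-one eigenspaces -/

/-- **`H^{2,0}(X²_p) ⊆ ⨁_{|β| = 1} V(β)`** (`p ≥ 4`): for a Hodge model `A` of `X²_p`, every class of the `(2,0)` type piece of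
`H²(X²_p(ℂ); ℂ)` lies in the span of the eigenspaces `V(β)` of the characters `β` with all `βᵢ ≠ 0` and `Σ ⟨βᵢ⟩ = p`. Indeed
`c = Σ_β π_β c` (`sum_eigenProjector_apply`, re-indexed by `fermatCharacterEquiv`), `π_β c ∈ V(β)` is again of type `(2,0)`
(`HodgeModel.pullback_eigenProjector_mem_hodgePQ`), and it vanishes when `Σ βᵢ ≠ 0` (`V(β) = 0`), when some `βᵢ = 0`
(`fermatEigenspace_twoZero_eq_zero_of_exists_eq_zero`) and when `Σ ⟨βᵢ⟩ ≥ 2p` (`fermatEigenspace_twoZero_eq_zero_of_two_le_level`).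
[cite: Shioda1979HodgeFermat, §1 (1.7)] [cite: Shioda1979PJA, §4] -/
theorem typePiece_twoZero_le_iSup_fermatEigenspace {p : ℕ} (hp : 4 ≤ p) (A : HodgeModel 2 (fermatHypersurface 2 p)) :
    A.typePiece 2 ⟨(2, 0), Finset.HasAntidiagonal.mem_antidiagonal.2 rfl⟩ ≤
      ⨆ β ∈ {β : Fin 4 → ZMod p | (∀ i, β i ≠ 0) ∧ ∑ i, (β i).val = p}, fermatEigenspace p β 2 := by
  classical
  haveI : NeZero p := ⟨by omega⟩
  have hX : IsSmoothProjective 2 (fermatHypersurface 2 p) := isSmoothProjective_fermatHypersurface (by norm_num) (by omega)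
  intro c hc
  have hcA : A.pullback 2 c ∈ A.hodgePQ 2 2 0 := hc
  have hG : fermatGroup 2 p ≤ diagonalStabilizer (fermatPolynomial ℂ 2 p) := fermatGroup_le_diagonalStabilizer p
  -- `c = Σ_β π_β c`
  have hsum : ∑ β : Fin 4 → ZMod p, eigenProjector (fermatPolynomial ℂ 2 p) (fermatCharacter p β) 2 hG c = c := by
    calc ∑ β : Fin 4 → ZMod p, eigenProjector (fermatPolynomial ℂ 2 p) (fermatCharacter p β) 2 hG c
        = ∑ χ : fermatGroup 2 p →* ℂˣ, eigenProjector (fermatPolynomial ℂ 2 p) χ 2 hG c :=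
          Fintype.sum_bijective _ fermatCharacter_bijective
            (fun β ↦ eigenProjector (fermatPolynomial ℂ 2 p) (fermatCharacter p β) 2 hG c)
            (fun χ ↦ eigenProjector (fermatPolynomial ℂ 2 p) χ 2 hG c) fun _ ↦ rfl
      _ = c := sum_eigenProjector_apply (fermatPolynomial ℂ 2 p) (hG := hG) c
  rw [← hsum]
  refine Submodule.sum_mem _ fun β _ ↦ ?_
  set π := eigenProjector (fermatPolynomial ℂ 2 p) (fermatCharacter p β) 2 hG c with hπ
  have hπV : π ∈ fermatEigenspace p β 2 := eigenProjector_mem (fermatPolynomial ℂ 2 p) hG c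
  have hπA : IsOfHodgeType 2 (fermatHypersurface 2 p) 2 2 0 π :=
    ⟨A, A.pullback_eigenProjector_mem_hodgePQ (fermatPolynomial ℂ 2 p) hG (fermatCharacter p β) hX hcA⟩
  by_cases hβ : (∀ i, β i ≠ 0) ∧ ∑ i, (β i).val = p
  · exact Submodule.mem_iSup_of_mem β (Submodule.mem_iSup_of_mem hβ hπV)
  · -- otherwise `π = 0`
    suffices h0 : π = 0 by rw [h0]; exact Submodule.zero_mem _
    by_cases hs : ∑ i, β i = 0
    · by_cases hz : ∃ i, β i = 0
      · exact fermatEigenspace_twoZero_eq_zero_of_exists_eq_zero hp A hs hz hπV hπA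
      · push Not at hz
        have hne : ∑ i, (β i).val ≠ p := fun h ↦ hβ ⟨hz, h⟩
        -- `p ∣ Σ ⟨βᵢ⟩`, `4 ≤ Σ ⟨βᵢ⟩`, `≠ p`: so `2p ≤ Σ ⟨βᵢ⟩`
        have hdvd : p ∣ ∑ i, (β i).val := by
          rw [← ZMod.natCast_eq_zero_iff, Nat.cast_sum]
          simpa [ZMod.natCast_zmod_val] using hs
        have hpos : ∀ i, 1 ≤ (β i).val := fun i ↦ Nat.one_le_iff_ne_zero.2 fun h ↦ hz i ((ZMod.val_eq_zero _).1 h)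
        have h4 : 4 ≤ ∑ i, (β i).val := by
          have h0 := hpos 0; have h1 := hpos 1; have h2 := hpos 2; have h3 := hpos 3
          simp only [Fin.sum_univ_four]; omega
        obtain ⟨q, hq⟩ := hdvd
        have hq2 : 2 ≤ q := by
          by_contra hlt
          push Not at hlt
          interval_cases q <;> omega
        have h2p : 2 * p ≤ ∑ i, (β i).val := by rw [hq]; nlinarith
        exact fermatEigenspace_twoZero_eq_zero_of_two_le_level hp A hz h2p hπV hπA
    · have hbot := fermatEigenspace_eq_bot_of_sum_ne_zero (n := 2) hs 2
      rw [hbot, Submodule.mem_bot] at hπV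
      exact hπV

/-! ### The bound and Shioda's value -/

/-- **`h^{2,0}(X²_p) ≤ C(p-1, 3)`** for the Fermat surface of degree `p ≥ 4`, on the tree's Hodge structure `H²(X²_p)`
(`BettiUniverse.hodge`): `h^{2,0} = dim` of the `(2,0)` type piece (`BettiUniverse.hodgeNumber_hodge_eq_finrank_typePiece`), which lies
in the span of one vector per level-one character (`typePiece_twoZero_le_iSup_fermatEigenspace`, `fermatEigenspace_le_span_of_ne_zero`),
and there are `C(p-1, 3)` of those (`card_levelOne_eq_choose`). In print: `p_g(X²_p) = C(p-1, 3)`, the number of monomials of degree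
`p - 4` in `4` variables (Shioda (1.7); Griffiths' residues). [cite: Shioda1979HodgeFermat, §1 (1.7)] -/
theorem hodgeNumber_two_zero_fermat_le {p : ℕ} (hp : 4 ≤ p) (hHD : exists_isReal_hodgeModel)
    (hX : IsSmoothProjective 2 (fermatHypersurface 2 p)) :
    (BettiUniverse.hodge hHD hX 2).hodgeNumber 2 0 ≤ Nat.choose (p - 1) 3 := by
  classical
  haveI : NeZero p := ⟨by omega⟩
  haveI := finite_complexBetti hX 2
  set A : HodgeModel 2 (fermatHypersurface 2 p) := BettiUniverse.realHodgeModel hHD hX with hA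
  have hnum := BettiUniverse.hodgeNumber_hodge_eq_finrank_typePiece hHD hX A (show 2 + 0 = 2 from rfl)
  simp only [Nat.cast_ofNat, Nat.cast_zero] at hnum
  rw [hnum]
  -- one spanning vector per non-zero character
  have hv : ∀ β : Fin 4 → ZMod p, ∃ v : complexBetti (fermatHypersurface 2 p) 2, β ≠ 0 → fermatEigenspace p β 2 ≤ ℂ ∙ v := by
    intro β
    by_cases hβ : β = 0
    · exact ⟨0, fun h ↦ absurd hβ h⟩
    · obtain ⟨v, hv⟩ := fermatEigenspace_le_span_of_ne_zero (NeZero.ne p) (le_refl 1) 0 hβ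
      exact ⟨v, fun _ ↦ hv⟩
  choose v hv using hv
  set B : Finset (Fin 4 → ZMod p) := Finset.univ.filter (fun β ↦ (∀ i, β i ≠ 0) ∧ ∑ i, (β i).val = p) with hB
  have hle : A.typePiece 2 ⟨(2, 0), Finset.HasAntidiagonal.mem_antidiagonal.2 rfl⟩ ≤
      Submodule.span ℂ (B.image v : Set (complexBetti (fermatHypersurface 2 p) 2)) := by
    refine (typePiece_twoZero_le_iSup_fermatEigenspace hp A).trans ?_
    refine iSup₂_le fun β hβ ↦ ?_
    have hβ0 : β ≠ 0 := fun h ↦ hβ.1 0 (by rw [h]; rfl)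
    refine (hv β hβ0).trans (Submodule.span_mono ?_)
    rw [Set.singleton_subset_iff, Finset.coe_image]
    exact ⟨β, by simpa [hB] using hβ, rfl⟩
  calc Module.finrank ℂ (A.typePiece 2 ⟨(2, 0), Finset.HasAntidiagonal.mem_antidiagonal.2 rfl⟩)
      ≤ Module.finrank ℂ (Submodule.span ℂ (B.image v : Set (complexBetti (fermatHypersurface 2 p) 2))) :=
        Submodule.finrank_mono hle
    _ ≤ (B.image v).card := finrank_span_finset_le_card _
    _ ≤ B.card := Finset.card_image_le
    _ = Nat.choose (p - 1) 3 := by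
        rw [← card_levelOne_eq_choose hp, Fintype.card_subtype]

/-- **Shioda's value `h^{2,0}(X²_p) = C(p-1, 3)`** (`p ≥ 4`): the upper bound `hodgeNumber_two_zero_fermat_le` with the tree's
residue lower bound (`fermatGenus_of_le` ∕ `CyclicUnitaryPowersK1OfFermatGenusLe`). [cite: Shioda1979HodgeFermat, §1 (1.7)]
[cite: VoisinHodgeII2003, §6.1.3 Cor. 6.12 (p = 1)] -/
theorem hodgeNumber_two_zero_fermat_eq ⦃p : ℕ⦄ (hp : p.Prime) (h5 : 5 ≤ p) (hHD : exists_isReal_hodgeModel)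
    (hX : IsSmoothProjective 2 (fermatHypersurface 2 p)) :
    (BettiUniverse.hodge hHD hX 2).hodgeNumber 2 0 = Nat.choose (p - 1) 3 :=
  fermatGenus_of_le (@fun _ _ h5' hHD' hX' ↦ hodgeNumber_two_zero_fermat_le (by omega) hHD' hX') hp h5 hHD hX

/-! ### K1-A from the two remaining named facts -/

/-- **K1-A ⟸ {F1‡, CDK}.** The crux `VeryGeneralDeckCommutatorsInHg` of route `CyclicUnitaryPowers` from the two named facts
`carlsonToledo1999_nodalMeridianLocalMonodromyBound` (F1‡: a meridian of the discriminant of degree-`p` surfaces acts on `H²` of the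
`p`-fold cyclic cover with `dim E_μ(T) ∩ … ≤ 1`, Carlson–Toledo 1999 §6) and `cmsp_nonHodgeGenericPoints_countable_algebraic_cover`
(CDK: Cattani–Deligne–Kaplan 1995 Thm. 1.1) ALONE — the geometric-genus input of the earlier cuts
(`veryGeneralDeckCommutatorsInHg_of_localMonodromyBound_fermatGenusLe`) is discharged by `hodgeNumber_two_zero_fermat_le`.
CONDITIONAL on F1‡ and CDK; rung F-H1 not moved. [cite: CarlsonToledo1999, §2, §5, §6 (kdoublept), §7 Theorem 7.1]
[cite: CattaniDeligneKaplan1995, Thm. 1.1 and Cor. 1.2] [cite: Shioda1979HodgeFermat, §1 (1.7)] -/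
theorem veryGeneralDeckCommutatorsInHg_of_localMonodromyBound_cdk
    (hF1 : carlsonToledo1999_nodalMeridianLocalMonodromyBound)
    (hCDK : cmsp_nonHodgeGenericPoints_countable_algebraic_cover) :
    Summit.HodgeConjecture.HodgeConjecture.Theses.CyclicUnitaryPowers.VeryGeneralDeckCommutatorsInHg :=
  veryGeneralDeckCommutatorsInHg_of_localMonodromyBound_fermatGenusLe hF1
    (@fun _ _ h5 hHD hX ↦ hodgeNumber_two_zero_fermat_le (by omega) hHD hX) @hCDK

/-- **The rung leaf `CyclicSurfacePowersHodge` ⟸ {F1‡, CDK}.** CONDITIONAL; rung F-H1 not moved.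
[cite: CarlsonToledo1999, §2, §5, §6 (kdoublept), §7 Theorem 7.1] [cite: CattaniDeligneKaplan1995, Thm. 1.1 and Cor. 1.2] -/
theorem cyclicSurfacePowersHodge_of_localMonodromyBound_cdk
    (hF1 : carlsonToledo1999_nodalMeridianLocalMonodromyBound)
    (hCDK : cmsp_nonHodgeGenericPoints_countable_algebraic_cover) :
    Summit.HodgeConjecture.HodgeConjecture.Theses.CyclicUnitaryPowers.CyclicSurfacePowersHodge :=
  cyclicSurfacePowersHodge_of_localMonodromyBound_fermatGenusLe hF1
    (@fun _ _ h5 hHD hX ↦ hodgeNumber_two_zero_fermat_le (by omega) hHD hX) @hCDK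

/-- **The F1† road: K1-A ⟸ {F1†, CDK}** (`carlsonToledo1999_nodalMeridianLocalMonodromy`, the equality form of the local
monodromy fact). CONDITIONAL. [cite: CarlsonToledo1999, §2, §5, §6, §7 Thm. 7.1] [cite: CattaniDeligneKaplan1995, Thm. 1.1 and Cor. 1.2] -/
theorem veryGeneralDeckCommutatorsInHg_of_localMonodromy_cdk
    (hF1 : carlsonToledo1999_nodalMeridianLocalMonodromy)
    (hCDK : cmsp_nonHodgeGenericPoints_countable_algebraic_cover) :
    Summit.HodgeConjecture.HodgeConjecture.Theses.CyclicUnitaryPowers.VeryGeneralDeckCommutatorsInHg :=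
  veryGeneralDeckCommutatorsInHg_of_localMonodromy_fermatGenusLe hF1
    (@fun _ _ h5 hHD hX ↦ hodgeNumber_two_zero_fermat_le (by omega) hHD hX) @hCDK

end Summit.HodgeConjecture.HodgeConjecture.Theorems.CyclicUnitaryPowersFermatGeometricGenusBound

end
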